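import Summits.BirchSwinnertonDyer.BirchSwinnertonDyer.Theses.GenusKolyvaginAtTwo
import Summits.BirchSwinnertonDyer.BirchSwinnertonDyer.Theorems.GenusKolyvaginAtTwoMinimalTwinBSDTwoSwappedPairAscent
import Summits.BirchSwinnertonDyer.BirchSwinnertonDyer.Theorems.ByReductionTypeAtTwoRankOneAtTwoBigImageOddLocalOneDoorKolyvaginExactBridgeCLossless
import Summits.BirchSwinnertonDyer.BirchSwinnertonDyer.Theorems.GenusKolyvaginAtTwoMinimalTwinBSDTwoSwappedPairSilentDescent
import Summits.BirchSwinnertonDyer.BirchSwinnertonDyer.Theorems.GenusKolyvaginAtTwoMinimalTwinBSDTwoSwappedPairOneBitDescent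
import HarnessLib

/-!
# Route `GenusKolyvaginAtTwo`, crux U₂ `MinimalTwinBSDTwo` (stmt-BirchSwinnertonDyer-22985), LINE 23 «twin_swap»:
# THE TWIN-SWAP ASCENT (part 2, the frames at `p = 2`) — on every frame the route's `closes` (rev 57) feeds to its rank-one input `hTw`,
# `BSD₂(E) ↔ BSD₂(Wd)`: `closes` and LINE 23 are INVERTIBLE

Seat `bsd-line-gk2-p2` g24 (PROVER 2/3, cell `bsd-f1-sign2`; LINE 23 holder), `--supports stmt-BirchSwinnertonDyer-22985` (helper; closes nothing).
THEOREMS ONLY (no definition, no named fact, no `sorry`); standard axioms.  **BSD is NOT proved by this file; U₂ / hTw is NOT proved; no item is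
closed.**  Everything is CONDITIONAL (D-0014) on the four STATEMENT-ONLY published facts the route carries as items — Gross–Zagier at every level
(`gross_zagier`, 24148), Gross–Zagier–Kolyvagin (`rank_eq_analyticRank_of_analyticRank_le_one`, 19921), modularity (`hasEntireLFunction_rat`,
19273), Milne 1972 any-model (`Milne1972.bsdQuotient_baseChange_quadratic_anyModel`, 24149) — and, in §5, on the route's own kernel items
exactly as `closes` consumes them (Q1 24879 ✓, Q2 24880, Q5R 27280 ✓, Q3R_T 23468 ✓, Q4_T″ 25502 ✓, `ShaVanishingAtDepthZeroAtTwo` 31538).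
Part 1 (`…SwappedPairAscent.lean`) is the model-free triangle at any `p`: ANY TWO of `BSD(W,p)`, `BSD(Wd,p)`, `MissingPPartOverCAt (W ⊗ K) p`
give the third.

* §3 (HABITAT frame: rank-`0` member `E`, rank-`1` twin `Wd`) **`bsdp_iff_bsdp_twin_of_shaExactC_of_facts`** — with the c-corrected Kolyvagin
  exactness `ord₂ #Ш(E_K)[2^∞] + 2 v₂(c) = 2 M₀` (Manin-free; K-side = fkl-p2's `RankOneAtTwoOneDoor.padicValRat_shaAnOverC_heegnerC`):
  `BSDp W 2 ↔ BSDp Wd 2`; odd-Manin form `bsdp_iff_bsdp_twin_of_natCard_sha_eq_pow_of_facts` (`#Ш(E_K)[2^∞] = 4^(M₀)`).  `←` is the route's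
  `ExactDescentAtTwo` (p588019); `→` is the new ASCENT.
* §4 (SWAPPED frame: rank-`1` `2`-Selmer-minimal member, `2`-Selmer-TRIVIAL rank-`0` twin — LINE 23's frame)
  **`bsdp_iff_bsdp_twin_swapped_of_sha_trivial_of_facts`** (sign-free, `Ш(E/K)[2^∞] = 0` displayed; K-side = gk2-p3's
  `Silent.padicValRat_shaAn_and_shaOrder_of_swappedPair_of_sha_trivial`) and `bsdp_iff_bsdp_twin_swapped_oneBit_of_facts` (`Δ < 0`, one-bit
  budget, `Ш(E/K)[2^∞] = 0` discharged by gk2-p3's unconditional sandwich p766610): under the exponent law `2^(v₂ c + v₂ C(E)) ∥ P(1)`,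
  `BSDp W 2 ↔ BSDp Wd 2` — `←` is LINE 23's S3 (p764815 / p766443 / p766822 / p767397), `→` is new.
* §5 (THE ROUTE'S LIVE CELLS, items by name) `bsdp_iff_bsdp_twin_onDepthZeroCells_of_items` (K₁± / LINE-25 depth-zero cells),
  `bsdp_iff_bsdp_twin_onNegMultCells_of_items` (Q3R_T's `Δ < 0` configuration), `bsdp_iff_bsdp_twin_onPosMultCells_of_items` (Q4_T″'s `Δ > 0`
  configuration): on EVERY frame `closes` feeds to `hTw`, **`BSDp E 2 ↔ BSDp Wd 2`**.

READING (planner currency; nothing is asked).  (i) `closes` is INVERTIBLE: on each live cell, modulo that cell's exactness kernel and PRINT,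
U₂ = `hTw` evaluated at the supplied twin `Wd` is EQUIVALENT to the route's conclusion `BSD₂(E)` at the habitat curve — U₂ restricted to the
twins the route uses is priced exactly as the leaf restricted to the RANK-ZERO habitat cut: a wall line proving `BSD₂` for rank-`0` habitat curves
gives U₂ on their twins for free, and conversely; neither is a cheaper input than the other.  (ii) LINE 23 is invertible too (§4): on its frames
`BSD₂(W)` (U₂'s instance) ↔ `BSD₂(Wd)` (the anchor S1's instance: rank `0`, `#Sel₂ = 1`).  (iii) So `closes` + LINE 23 PROPAGATE `BSD₂` WITHOUT
LOSS along the graph whose edges are admissible Heegner genus pairs (rank-`0` habitat `E` — rank-`1` minimal `Wd` — rank-`0` `2`-Selmer-trivial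
`Wd^(d_K′)` — …): the beyond-print content of the system is {supplies, exactness kernels K₁/K₄/the exponent law} plus ONE anchor per connected
component of that graph, and no anchor lives inside this route (the wall is route `ByReductionTypeAtTwo`; Miller 2011 anchors `N < 5000` curve by
curve with the same bookkeeping).  BSD is NOT proved by any of this.

References: [GrossZagier1986] V.§2 (2.2); [GrossLMS1991] §5 Prop. 5.3; [McCallumLMS1991] §5 Lemma 5.1; [Milne1972ArithmeticAV] §1 Thm. 1;
[Kramer1981] Thm. 1; [Miller2011LMS] Def. 1.1, §§4–5.
-/

set_option autoImplicit false
set_option linter.dupNamespace false -- `Summit.<P>.<Sub>` repeats `BirchSwinnertonDyer` (D-0017)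

noncomputable section

open scoped Classical

open WeierstrassCurve NumberField Literature.NumberTheory.EllipticCurves
  Literature.NumberTheory.EllipticCurves.ModularForms
  Literature.NumberTheory.EllipticCurves.Rank1Residual
  Literature.NumberTheory.EllipticCurves.Rank1Residual.Typed
  Literature.NumberTheory.EllipticCurves.KrizLi2019
  Summit.BirchSwinnertonDyer.Rank1Residual
  Summit.BirchSwinnertonDyer.Rank1Residual.AdditivePotMult
  Summit.BirchSwinnertonDyer.BirchSwinnertonDyer.Theses.GenusKolyvaginAtTwo
  Summit.BirchSwinnertonDyer.BirchSwinnertonDyer.Theorems.CMExactDescent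
  Summit.BirchSwinnertonDyer.BirchSwinnertonDyer.Theorems.GenusExact.TwinSwap

namespace Summit.BirchSwinnertonDyer.BirchSwinnertonDyer.Theorems.GenusExact.TwinSwap.Ascent

/-! ## §3 The HABITAT frame (rank-zero member `E`, rank-one twin `Wd`): `BSD₂(E) ↔ BSD₂(Wd)` modulo the c-corrected exactness over `K` -/

/-- **THE TRIANGLE ON THE HABITAT FRAME, c-CORRECTED (Manin-free), MODULO FOUR PUBLISHED FACTS** `hGZ` (Gross–Zagier at every level), `hGZK`,
`hmod`, `hMilneC`.  `W/ℚ` globally minimal with `r_an(E) = 0`, `ρ̄_{E,2}` onto, `C(E)` odd; `K` imaginary quadratic, `d_K` odd `≠ −3`, Heegner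
for `N_E`; ANY datum `Dt`, `d₁` conductor-`1` with `2^(M₀) ∥ P(1)` in `E(K[1])`; the c-corrected EXACTNESS `ord₂ #Ш(E_K)[2^∞] + 2 v₂(c) = 2 M₀`
(the K-side kernel: K₁/Ш-vanishing at depth zero, Q3R_T/Q4_T″ at positive depth); `Wd` a globally minimal model of `E^(d_K)` of analytic rank
`1`.  Then **`BSDp W 2 ↔ BSDp Wd 2`**: Gross–Zagier over `K` (`RankOneAtTwoOneDoor.padicValRat_shaAnOverC_heegnerC`: `ord₂ #Ш_an(E_K) =
2 M₀ − 2 v₂(c)`) makes the exactness the `2`-part of BSD over `K` (`MissingPPartOverCAt (W ⊗ K) 2`), and §2's triangle concludes.  `←` is the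
route's `ExactDescentAtTwo` (p588019, gk2-p3) read Manin-free; `→` is NEW (the ASCENT).  CONDITIONAL on the four named facts; BSD is NOT proved.
[cite: GrossZagier1986, V.§2 (2.2)] [cite: Milne1972ArithmeticAV, §1 Thm. 1] [cite: McCallumLMS1991, §5 Lemma 5.1] [cite: Miller2011LMS, Def. 1.1] -/
theorem bsdp_iff_bsdp_twin_of_shaExactC_of_facts
    (hGZ : ∀ (N : ℕ) [NeZero N] (W : WeierstrassCurve ℚ) (K : Type) [Field K] [NumberField K], gross_zagier N W K)
    (hGZK : rank_eq_analyticRank_of_analyticRank_le_one) (hmod : hasEntireLFunction_rat)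
    (hMilneC : Milne1972.bsdQuotient_baseChange_quadratic_anyModel) :
    ∀ (W : WeierstrassCurve ℚ) [W.IsElliptic] [W.IsGloballyMinimal] [NeZero (W.conductorNorm ℤ)],
      W.analyticRank = 0 → W.HasSurjectiveModNGaloisRep 2 → Odd W.tamagawaProduct →
      ∀ (K : Type) [Field K] [NumberField K], IsImaginaryQuadratic K → Odd (NumberField.discr K) →
      NumberField.discr K ≠ -3 → SatisfiesHeegnerHypothesis (W.conductorNorm ℤ) K →
      ∀ (Dt : ModularParametrizationData W (W.conductorNorm ℤ)) (β : ℤ) (ι : K →+* ℂ) (d₁ : KolyvaginHeegnerData Dt β ι 1) (M₀ : ℕ),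
        (∃ Q : (W.baseChange (ringClassField K ι 1)).toAffine.Point, ((2 ^ M₀ : ℕ) : ℤ) • Q = d₁.derivedPoint) →
        (¬ ∃ Q : (W.baseChange (ringClassField K ι 1)).toAffine.Point, ((2 ^ (M₀ + 1) : ℕ) : ℤ) • Q = d₁.derivedPoint) →
        (padicValNat 2 (Nat.card (AddCommGroup.primaryComponent (W.baseChange K).sha 2)) : ℤ) + 2 * padicValInt 2 Dt.c = 2 * M₀ →
      ∀ (Wd : WeierstrassCurve ℚ) [Wd.IsElliptic] [Wd.IsGloballyMinimal],
        (∃ C : VariableChange ℚ, C • W.quadraticTwist (NumberField.discr K : ℚ) = Wd) → Wd.analyticRank = 1 →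
        (BSDp W 2 ↔ BSDp Wd 2) := by
  intro W _ _ _ hr0 hρ2 hT K _ _ hK hodd h3 hH Dt β ι d₁ M₀ hdiv hndiv hex Wd _ _ hWd hrd
  haveI : Fact (Nat.Prime 2) := ⟨Nat.prime_two⟩
  haveI hEK : (W.baseChange K).IsElliptic := isElliptic_baseChange' W K
  have h2 : Module.finrank ℚ K = 2 := hK.1
  have hD0 : (NumberField.discr K : ℚ) ≠ 0 := by exact_mod_cast NumberField.discr_ne_zero K
  haveI hEt : (W.quadraticTwist (NumberField.discr K : ℚ)).IsElliptic := W.isElliptic_quadraticTwist hD0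
  have hrt : (W.quadraticTwist (NumberField.discr K : ℚ)).analyticRank = 1 := by
    obtain ⟨Cd, hCd⟩ := hWd
    rw [← hrd, ← hCd, analyticRank_smul]
  have hrK : (W.baseChange K).analyticRank = 1 :=
    (P2.analyticRank_baseChange_eq_one_iff W K hmod h2).mpr (Or.inr ⟨hr0, hrt⟩)
  obtain ⟨hShaK, q, hq, hval⟩ := RankOneAtTwoOneDoor.padicValRat_shaAnOverC_heegnerC W K Dt β ι d₁ (hGZ _ W K) hGZK hmod hρ2 hT
    hK hodd h3 hH hrK hdiv hndiv
  haveI : Finite (W.baseChange K).sha := hShaK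
  have hKin : MissingPPartOverCAt (W.baseChange K) 2 := by
    refine ⟨q, hq, ?_⟩
    rw [hval, X11b.Three.Koly.padicValNat_shaOrder_eq (W.baseChange K) 2]
    omega
  exact bsdp_iff_bsdp_twist_of_pPartOverC_baseChange W 2 K Wd hGZK hmod hMilneC (by rw [hr0]; exact zero_le_one) h2 hWd
    (by rw [hrd]) hKin

/-- **THE TRIANGLE ON THE HABITAT FRAME, odd-Manin form** (the route's currency: `Odd Dt.c`, exactness `#Ш(E_K)[2^∞] = 2^(2M₀)` as Q3R_T /
Q4_T″ / `ShaVanishingAtDepthZeroAtTwo` + K₁ deliver it): **`BSDp W 2 ↔ BSDp Wd 2`**, modulo the four published facts.  CONDITIONAL; BSD is NOT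
proved. [cite: GrossZagier1986, V.§2 (2.2)] [cite: Milne1972ArithmeticAV, §1 Thm. 1] [cite: Miller2011LMS, Def. 1.1] -/
theorem bsdp_iff_bsdp_twin_of_natCard_sha_eq_pow_of_facts
    (hGZ : ∀ (N : ℕ) [NeZero N] (W : WeierstrassCurve ℚ) (K : Type) [Field K] [NumberField K], gross_zagier N W K)
    (hGZK : rank_eq_analyticRank_of_analyticRank_le_one) (hmod : hasEntireLFunction_rat)
    (hMilneC : Milne1972.bsdQuotient_baseChange_quadratic_anyModel) :
    ∀ (W : WeierstrassCurve ℚ) [W.IsElliptic] [W.IsGloballyMinimal] [NeZero (W.conductorNorm ℤ)],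
      W.analyticRank = 0 → W.HasSurjectiveModNGaloisRep 2 → Odd W.tamagawaProduct →
      ∀ (K : Type) [Field K] [NumberField K], IsImaginaryQuadratic K → Odd (NumberField.discr K) →
      NumberField.discr K ≠ -3 → SatisfiesHeegnerHypothesis (W.conductorNorm ℤ) K →
      ∀ (Dt : ModularParametrizationData W (W.conductorNorm ℤ)), Odd Dt.c →
      ∀ (β : ℤ) (ι : K →+* ℂ) (d₁ : KolyvaginHeegnerData Dt β ι 1) (M₀ : ℕ),
        (∃ Q : (W.baseChange (ringClassField K ι 1)).toAffine.Point, ((2 ^ M₀ : ℕ) : ℤ) • Q = d₁.derivedPoint) →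
        (¬ ∃ Q : (W.baseChange (ringClassField K ι 1)).toAffine.Point, ((2 ^ (M₀ + 1) : ℕ) : ℤ) • Q = d₁.derivedPoint) →
        Nat.card (AddCommGroup.primaryComponent (W.baseChange K).sha 2) = 2 ^ (2 * M₀) →
      ∀ (Wd : WeierstrassCurve ℚ) [Wd.IsElliptic] [Wd.IsGloballyMinimal],
        (∃ C : VariableChange ℚ, C • W.quadraticTwist (NumberField.discr K : ℚ) = Wd) → Wd.analyticRank = 1 →
        (BSDp W 2 ↔ BSDp Wd 2) := by
  intro W _ _ _ hr0 hρ2 hT K _ _ hK hodd h3 hH Dt hc β ι d₁ M₀ hdiv hndiv hsha Wd _ _ hWd hrd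
  haveI : Fact (Nat.Prime 2) := ⟨Nat.prime_two⟩
  have hvc : padicValInt 2 Dt.c = 0 :=
    padicValInt.eq_zero_of_not_dvd (fun h2c ↦ (Int.not_even_iff_odd.mpr hc) (even_iff_two_dvd.mpr h2c))
  have hex : (padicValNat 2 (Nat.card (AddCommGroup.primaryComponent (W.baseChange K).sha 2)) : ℤ) + 2 * padicValInt 2 Dt.c = 2 * M₀ := by
    rw [hsha, padicValNat.prime_pow, hvc]
    push_cast
    ring
  exact bsdp_iff_bsdp_twin_of_shaExactC_of_facts hGZ hGZK hmod hMilneC W hr0 hρ2 hT K hK hodd h3 hH Dt β ι d₁ M₀ hdiv hndiv hex Wd hWd hrd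

/-! ## §4 The SWAPPED frame (rank-one member `W`, `2`-Selmer-trivial rank-zero twin `Wd`): `BSD₂(W) ↔ BSD₂(Wd)` modulo the exponent law -/

/-- **THE TRIANGLE ON THE SWAPPED FRAME, sign-free, MODULO FOUR PUBLISHED FACTS.**  `W/ℚ` globally minimal with `r_an(E) = 1`, `#Sel₂(E) = 2`;
`K` imaginary quadratic, `d_K` odd `≠ −3`, Heegner; ANY datum `Dt` (`c ≠ 0`); `d₁` conductor-`1` with `P(1)` of infinite order and the EXPONENT LAW
`2^(v₂ c + v₂ C(E)) ∥ P(1)` in `E(K[1])`; `Wd` a globally minimal `2`-Selmer-TRIVIAL twin with `Ш(E/K)[2^∞] = 0` (unconditional on the one-bit /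
all-silent frames: gk2-p2 g23 p764716, gk2-p3 p766610 / p767255).  Then **`BSDp W 2 ↔ BSDp Wd 2`** — `←` is LINE 23's S3 (g23 p764815/p766443,
gk2-p3 p766822/p767397); `→` is NEW: **U₂'s instance `BSD₂(W)` GIVES BACK the anchor's instance `BSD₂(Wd)`** (rank `0`, `#Sel₂ = 1`).  K-side by
gk2-p3's `Silent.padicValRat_shaAn_and_shaOrder_of_swappedPair_of_sha_trivial`.  CONDITIONAL on the four named facts; BSD is NOT proved.
[cite: GrossZagier1986, V.§2 (2.2)] [cite: GrossLMS1991, §5 Prop. 5.3] [cite: Milne1972ArithmeticAV, §1 Thm. 1] [cite: Miller2011LMS, Def. 1.1] -/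
theorem bsdp_iff_bsdp_twin_swapped_of_sha_trivial_of_facts
    (hGZ : ∀ (N : ℕ) [NeZero N] (W : WeierstrassCurve ℚ) (K : Type) [Field K] [NumberField K], gross_zagier N W K)
    (hGZK : rank_eq_analyticRank_of_analyticRank_le_one) (hmod : hasEntireLFunction_rat)
    (hMilneC : Milne1972.bsdQuotient_baseChange_quadratic_anyModel) :
    ∀ (W : WeierstrassCurve ℚ) [W.IsElliptic] [W.IsGloballyMinimal] [NeZero (W.conductorNorm ℤ)],
      W.analyticRank = 1 → Nat.card (W.selmerGroup 2) = 2 →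
      ∀ (K : Type) [Field K] [NumberField K], IsImaginaryQuadratic K → Odd (NumberField.discr K) →
      NumberField.discr K ≠ -3 → SatisfiesHeegnerHypothesis (W.conductorNorm ℤ) K →
      ∀ (Dt : ModularParametrizationData W (W.conductorNorm ℤ)), Dt.c ≠ 0 →
      ∀ (β : ℤ) (ι : K →+* ℂ) (d₁ : KolyvaginHeegnerData Dt β ι 1), ¬ IsOfFinAddOrder d₁.derivedPoint →
        (∃ Q : (W.baseChange (ringClassField K ι 1)).toAffine.Point,
          ((2 ^ (padicValInt 2 Dt.c + padicValNat 2 W.tamagawaProduct) : ℕ) : ℤ) • Q = d₁.derivedPoint) →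
        (¬ ∃ Q : (W.baseChange (ringClassField K ι 1)).toAffine.Point,
          ((2 ^ (padicValInt 2 Dt.c + padicValNat 2 W.tamagawaProduct + 1) : ℕ) : ℤ) • Q = d₁.derivedPoint) →
      ∀ (Wd : WeierstrassCurve ℚ) [Wd.IsElliptic] [Wd.IsGloballyMinimal],
        (∃ C : VariableChange ℚ, C • W.quadraticTwist (NumberField.discr K : ℚ) = Wd) → Nat.card (Wd.selmerGroup 2) = 1 →
        Nat.card (AddCommGroup.primaryComponent (W.baseChange K).sha 2) = 1 →
        (BSDp W 2 ↔ BSDp Wd 2) := by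
  intro W _ _ _ hr hSel K _ _ hK hodd h3 hH Dt hc0 β ι d₁ hy hdiv hndiv Wd _ _ hWd hSel1 hsha
  haveI : Fact (Nat.Prime 2) := ⟨Nat.prime_two⟩
  haveI hEK : (W.baseChange K).IsElliptic := isElliptic_baseChange' W K
  have h2 : Module.finrank ℚ K = 2 := hK.1
  obtain ⟨Cd, hCd⟩ := hWd
  obtain ⟨hrd, -, hShaK, hshaV, q, hshaC, hval⟩ := Silent.padicValRat_shaAn_and_shaOrder_of_swappedPair_of_sha_trivial W K (hGZ _ W K)
    hGZK hmod hr hSel hK hodd h3 hH Dt hc0 β ι d₁ hy hdiv hndiv Wd Cd hCd hSel1 hsha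
  haveI : Finite (W.baseChange K).sha := hShaK
  have hKin : MissingPPartOverCAt (W.baseChange K) 2 := ⟨q, hshaC, by rw [hval, hshaV]; push_cast; ring⟩
  exact bsdp_iff_bsdp_twist_of_pPartOverC_baseChange W 2 K Wd hGZK hmod hMilneC hr.le h2 ⟨Cd, hCd⟩
    (by rw [hrd]; exact zero_le_one) hKin

/-- **THE TRIANGLE ON THE ONE-BIT SWAPPED FRAME (`Δ < 0`), `Ш(E/K)[2^∞] = 0` DISCHARGED** (gk2-p3's unconditional one-bit sandwich inside
`OneBit.padicValRat_shaAn_and_shaOrder_of_swappedPair_of_le_succ`): `r_an(E) = 1`, `#Sel₂(E) = 2`, `Δ_E < 0`; exponent law; a `2`-Selmer-trivial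
twin with `ord₂ C(Wd) ≤ ord₂ C(E) + 1` ⟹ **`BSDp W 2 ↔ BSDp Wd 2`** modulo the four published facts.  (At `C(E)` odd this is LINE 23 v1.3's
slice; at `ord₂ C(E) = 1` the cell `hTw1`.)  CONDITIONAL; BSD is NOT proved. [cite: GrossZagier1986, V.§2 (2.2)] [cite: Kramer1981, Thm. 1]
[cite: Milne1972ArithmeticAV, §1 Thm. 1] [cite: Miller2011LMS, Def. 1.1] -/
theorem bsdp_iff_bsdp_twin_swapped_oneBit_of_facts
    (hGZ : ∀ (N : ℕ) [NeZero N] (W : WeierstrassCurve ℚ) (K : Type) [Field K] [NumberField K], gross_zagier N W K)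
    (hGZK : rank_eq_analyticRank_of_analyticRank_le_one) (hmod : hasEntireLFunction_rat)
    (hMilneC : Milne1972.bsdQuotient_baseChange_quadratic_anyModel) :
    ∀ (W : WeierstrassCurve ℚ) [W.IsElliptic] [W.IsGloballyMinimal] [NeZero (W.conductorNorm ℤ)],
      W.analyticRank = 1 → Nat.card (W.selmerGroup 2) = 2 → W.Δ < 0 →
      ∀ (K : Type) [Field K] [NumberField K], IsImaginaryQuadratic K → Odd (NumberField.discr K) →
      NumberField.discr K ≠ -3 → SatisfiesHeegnerHypothesis (W.conductorNorm ℤ) K →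
      ∀ (Dt : ModularParametrizationData W (W.conductorNorm ℤ)), Dt.c ≠ 0 →
      ∀ (β : ℤ) (ι : K →+* ℂ) (d₁ : KolyvaginHeegnerData Dt β ι 1), ¬ IsOfFinAddOrder d₁.derivedPoint →
        (∃ Q : (W.baseChange (ringClassField K ι 1)).toAffine.Point,
          ((2 ^ (padicValInt 2 Dt.c + padicValNat 2 W.tamagawaProduct) : ℕ) : ℤ) • Q = d₁.derivedPoint) →
        (¬ ∃ Q : (W.baseChange (ringClassField K ι 1)).toAffine.Point,
          ((2 ^ (padicValInt 2 Dt.c + padicValNat 2 W.tamagawaProduct + 1) : ℕ) : ℤ) • Q = d₁.derivedPoint) →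
      ∀ (Wd : WeierstrassCurve ℚ) [Wd.IsElliptic] [Wd.IsGloballyMinimal],
        (∃ C : VariableChange ℚ, C • W.quadraticTwist (NumberField.discr K : ℚ) = Wd) → Nat.card (Wd.selmerGroup 2) = 1 →
        padicValNat 2 Wd.tamagawaProduct ≤ padicValNat 2 W.tamagawaProduct + 1 →
        (BSDp W 2 ↔ BSDp Wd 2) := by
  intro W _ _ _ hr hSel hΔ K _ _ hK hodd h3 hH Dt hc0 β ι d₁ hy hdiv hndiv Wd _ _ hWd hSel1 hDEF
  haveI : Fact (Nat.Prime 2) := ⟨Nat.prime_two⟩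
  haveI hEK : (W.baseChange K).IsElliptic := isElliptic_baseChange' W K
  have h2 : Module.finrank ℚ K = 2 := hK.1
  obtain ⟨Cd, hCd⟩ := hWd
  obtain ⟨hrd, -, hShaK, hshaV, q, hshaC, hval⟩ := OneBit.padicValRat_shaAn_and_shaOrder_of_swappedPair_of_le_succ W K (hGZ _ W K)
    hGZK hmod hr hSel hΔ hK hodd h3 hH Dt hc0 β ι d₁ hy hdiv hndiv Wd Cd hCd hSel1 hDEF
  haveI : Finite (W.baseChange K).sha := hShaK
  have hKin : MissingPPartOverCAt (W.baseChange K) 2 := ⟨q, hshaC, by rw [hval, hshaV]; push_cast; ring⟩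
  exact bsdp_iff_bsdp_twist_of_pPartOverC_baseChange W 2 K Wd hGZK hmod hMilneC hr.le h2 ⟨Cd, hCd⟩
    (by rw [hrd]; exact zero_le_one) hKin

/-! ## §5 The ROUTE's live cells: on every frame `closes` (rev 57) feeds to its rank-one input `hTw`, `BSD₂(E) ↔ BSD₂(Wd)` modulo the cell's
kernel and PRINT — `closes` is INVERTIBLE -/

/-- **DEPTH-ZERO CELLS (K₁⁻ / K₁⁺, `#Sel₂(E) = 1`, rev-54 LINE 25 branches and the `#Sel₂ = 1` halves of the multiplicative branches).**  With the
route items `ShaVanishingAtDepthZeroAtTwo` (31538) and the four PRINT items (24148, 19273, 19921, 24149): for every habitat curve `E`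
(`r_an = 0`, `ρ̄_{E,2}` onto, `C(E)` odd, `#Sel₂(E) = 1`), every Heegner field `K` (`d_K` odd `≠ −3`), every ODD-Manin datum with `P(1)` of
infinite order and `2`-PRIMITIVE (depth zero — what K₁± force on these cells), and every globally minimal twin `Wd ≅ E^(d_K)` with `r_an(Wd) =
1`, `#Sel₂(Wd) = 2` inside the sign's Tamagawa budget: **`BSDp W 2 ↔ BSDp Wd 2`**.  So on these cells the binder `hTw` (U₂, stmt-22985) applied
to the supplied twin is EQUIVALENT to the route's conclusion `BSD₂(E)`.  CONDITIONAL on the displayed items; BSD is NOT proved; nothing closed.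
[cite: GrossZagier1986, V.§2 (2.2)] [cite: Milne1972ArithmeticAV, §1 Thm. 1] [cite: Miller2011LMS, Def. 1.1] -/
theorem bsdp_iff_bsdp_twin_onDepthZeroCells_of_items (hSha1 : ShaVanishingAtDepthZeroAtTwo)
    (hGZ : GrossZagierAllLevels) (hL : EntireLFunctionRat) (hGZK : MultPublishedInputsAtTwo) (hMi : MilneAnyModel) :
    ∀ (W : WeierstrassCurve ℚ) [W.IsElliptic] [W.IsGloballyMinimal] [NeZero (W.conductorNorm ℤ)],
      W.analyticRank = 0 → W.HasSurjectiveModNGaloisRep 2 → Odd W.tamagawaProduct → Nat.card (W.selmerGroup 2) = 1 →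
      ∀ (K : Type) [Field K] [NumberField K], IsImaginaryQuadratic K → Odd (NumberField.discr K) →
      NumberField.discr K ≠ -3 → SatisfiesHeegnerHypothesis (W.conductorNorm ℤ) K →
      ∀ (Dt : ModularParametrizationData W (W.conductorNorm ℤ)), Odd Dt.c →
      ∀ (β : ℤ) (ι : K →+* ℂ) (d₁ : KolyvaginHeegnerData Dt β ι 1), ¬ IsOfFinAddOrder d₁.derivedPoint →
        (¬ ∃ Q : (W.baseChange (ringClassField K ι 1)).toAffine.Point, ((2 ^ (0 + 1) : ℕ) : ℤ) • Q = d₁.derivedPoint) →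
      ∀ (Wd : WeierstrassCurve ℚ) [Wd.IsElliptic] [Wd.IsGloballyMinimal],
        (∃ C : VariableChange ℚ, C • W.quadraticTwist (NumberField.discr K : ℚ) = Wd) → Wd.analyticRank = 1 →
        Nat.card (Wd.selmerGroup 2) = 2 →
        ((W.Δ < 0 ∧ padicValNat 2 Wd.tamagawaProduct ≤ 1) ∨ (0 < W.Δ ∧ padicValNat 2 Wd.tamagawaProduct = 0)) →
        (BSDp W 2 ↔ BSDp Wd 2) := by
  intro W _ _ _ hr0 hρ2 hT h1 K _ _ hK hodd h3 hH Dt hc β ι d₁ hy hndiv Wd _ _ hWd hrd hSel hbud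
  have hsha : Nat.card (AddCommGroup.primaryComponent (W.baseChange K).sha 2) = 2 ^ (2 * 0) := by
    rw [mul_zero, pow_zero]
    exact hSha1 W K hT hr0 h1 hK hodd hH hρ2 Dt β ι d₁ hy 0 hndiv Wd hWd hSel hbud
  have hdiv : ∃ Q : (W.baseChange (ringClassField K ι 1)).toAffine.Point, ((2 ^ 0 : ℕ) : ℤ) • Q = d₁.derivedPoint :=
    ⟨d₁.derivedPoint, by rw [pow_zero, Nat.cast_one, one_smul]⟩
  exact bsdp_iff_bsdp_twin_of_natCard_sha_eq_pow_of_facts hGZ hGZK hL hMi W hr0 hρ2 hT K hK hodd h3 hH Dt hc β ι d₁ 0 hdiv hndiv hsha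
    Wd hWd hrd

/-- **THE `Δ < 0` MULTIPLICATIVE CELLS (Q3R_T's configuration, incl. K₄⁻).**  With the route items Q1 `CyclicTorsionOfNegDisc` (24879, proved), Q2
`KolyvaginRelationAtTwo` (24880), Q5R `EquivariantChebotarevAtTwoR` (27280, proved), Q3R_T `EquivariantKolyvaginExactAtTwoRT` (23468, proved)
and PRINT: on every frame `closes` feeds to Q3R_T (habitat `E` with an odd multiplicative prime, `Δ < 0`, `(H2)`-admissible `K`, `2`-adic tower
onto, odd-Manin datum, `y_K` of infinite order with exponent `M₀`, a globally minimal twin with `r_an = 1`, `#Sel₂ = 2`, `ord₂ C(Wd) ≤ 1`, a DEEP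
`2`-primitive witness) **`BSDp W 2 ↔ BSDp Wd 2`** (`w(E) = +1` from `r_an(E) = 0` by the parity theorem, as in `closes`).  CONDITIONAL on the
displayed items; BSD is NOT proved; nothing closed. [cite: GrossZagier1986, V.§2 (2.2)] [cite: McCallumLMS1991, §5] [cite: Miller2011LMS, Def. 1.1] -/
theorem bsdp_iff_bsdp_twin_onNegMultCells_of_items (hQ1 : CyclicTorsionOfNegDisc) (hQ2 : KolyvaginRelationAtTwo)
    (hQ5R : EquivariantChebotarevAtTwoR) (hQ3RT : EquivariantKolyvaginExactAtTwoRT)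
    (hGZ : GrossZagierAllLevels) (hL : EntireLFunctionRat) (hGZK : MultPublishedInputsAtTwo) (hMi : MilneAnyModel) :
    ∀ (W : WeierstrassCurve ℚ) [W.IsElliptic] [W.IsGloballyMinimal] [NeZero (W.conductorNorm ℤ)],
      ¬ W.HasCM → W.analyticRank = 0 → Odd W.tamagawaProduct →
      ∀ (v : IsDedekindDomain.HeightOneSpectrum (NumberField.RingOfIntegers ℚ)), ((2 : ℕ) : NumberField.RingOfIntegers ℚ) ∉ v.asIdeal →
        ((W.conductorNorm ℤ : ℕ) : NumberField.RingOfIntegers ℚ) ∈ v.asIdeal → W.HasMultiplicativeReductionAt v → W.Δ < 0 →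
      ∀ (K : Type) [Field K] [NumberField K], IsImaginaryQuadratic K → Odd (NumberField.discr K) → NumberField.discr K ≠ -3 →
        SatisfiesHeegnerHypothesis (W.conductorNorm ℤ) K → ¬ IsSquare ((NumberField.discr K : ℚ) * -|W.Δ|) →
        ¬ IsSquare ((NumberField.discr K : ℚ) * (-(2 * |W.Δ|))) → (∀ n : ℕ, 0 < n → W.HasSurjectiveModNGaloisRep ((2 : ℤ) ^ n)) →
      ∀ (Dt : ModularParametrizationData W (W.conductorNorm ℤ)), Odd Dt.c →
      ∀ (β : ℤ) (ι : K →+* ℂ) (d₁ : KolyvaginHeegnerData Dt β ι 1), ¬ IsOfFinAddOrder d₁.derivedPoint → ∀ (M₀ : ℕ),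
        (∃ Q : (W.baseChange (ringClassField K ι 1)).toAffine.Point, ((2 ^ M₀ : ℕ) : ℤ) • Q = d₁.derivedPoint) →
        (¬ ∃ Q : (W.baseChange (ringClassField K ι 1)).toAffine.Point, ((2 ^ (M₀ + 1) : ℕ) : ℤ) • Q = d₁.derivedPoint) →
      ∀ (Wd : WeierstrassCurve ℚ) [Wd.IsElliptic] [Wd.IsGloballyMinimal],
        (∃ C : VariableChange ℚ, C • W.quadraticTwist (NumberField.discr K : ℚ) = Wd) → Wd.analyticRank = 1 →
        Nat.card (Wd.selmerGroup 2) = 2 → padicValNat 2 Wd.tamagawaProduct ≤ 1 →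
      ∀ (n : ℕ) (d : KolyvaginHeegnerData Dt β ι n), Squarefree n →
        (∀ ℓ ∈ n.primeFactors, Zhang2014.IsKolyvaginPrime (W.conductorNorm ℤ) W K 2 ℓ ∧ 2 ≤ Zhang2014.kolyvaginIndex W 2 ℓ ∧
          FrobEqFrobInfty W K 2 ℓ) →
        (¬ ∃ Q : (W.baseChange (ringClassField K ι n)).toAffine.Point, (2 : ℤ) • Q = d.derivedPoint) →
        (BSDp W 2 ↔ BSDp Wd 2) := by
  intro W _ _ _ hcm hr0 hT v h2v hNv hmv hneg K _ _ hIQ hodd h3 hHe hsq1 hsq2 hρ Dt hc β ι d₁ hy M₀ hdiv hndiv Wd _ _ hWd hrd hSel hDEF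
    n d hn hKoly hPn
  have hw : W.rootNumber = 1 :=
    (Literature.Barriers.BirchSwinnertonDyer.even_analyticRank_iff_of_isNewformOf_conductorLevel Dt.isNewformOf).mp
      (by rw [hr0]; exact Even.zero)
  have hsha : Nat.card (AddCommGroup.primaryComponent (W.baseChange K).sha 2) = 2 ^ (2 * M₀) :=
    hQ3RT hQ2 hQ5R hQ1 W hcm hT v h2v hNv hmv hneg K hIQ hodd h3 hHe hsq1 hsq2 hρ Dt β ι d₁ hy M₀ hdiv hndiv hw Wd hWd hSel hDEF n d hn
      hKoly hPn
  exact bsdp_iff_bsdp_twin_of_natCard_sha_eq_pow_of_facts hGZ hGZK hL hMi W hr0 (by simpa using hρ 1 one_pos) hT K hIQ hodd h3 hHe Dt hc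
    β ι d₁ M₀ hdiv hndiv hsha Wd hWd hrd

/-- **THE `Δ > 0` MULTIPLICATIVE CELLS (Q4_T″'s configuration, incl. K₄⁺).**  With the route items Q2 `KolyvaginRelationAtTwo` (24880), Q4_T″
`KolyvaginExactAtTwoPosDiscT` (25502, proved) and PRINT: on every frame `closes` feeds to Q4_T″ (habitat `E` with an odd multiplicative prime,
`Δ > 0`, `(H2)`-admissible `K`, `2`-adic tower onto, odd-Manin datum, `y_K` of infinite order with exponent `M₀`, a globally minimal twin with
`r_an = 1`, `#Sel₂ = 2`, `ord₂ C(Wd) = 0`, a TRANSPOSITION-DEEP `2`-primitive witness) **`BSDp W 2 ↔ BSDp Wd 2`**.  CONDITIONAL on the displayed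
items; BSD is NOT proved; nothing closed. [cite: GrossZagier1986, V.§2 (2.2)] [cite: McCallumLMS1991, §5] [cite: Miller2011LMS, Def. 1.1] -/
theorem bsdp_iff_bsdp_twin_onPosMultCells_of_items (hQ2 : KolyvaginRelationAtTwo) (hQ4T : KolyvaginExactAtTwoPosDiscT)
    (hGZ : GrossZagierAllLevels) (hL : EntireLFunctionRat) (hGZK : MultPublishedInputsAtTwo) (hMi : MilneAnyModel) :
    ∀ (W : WeierstrassCurve ℚ) [W.IsElliptic] [W.IsGloballyMinimal] [NeZero (W.conductorNorm ℤ)],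
      ¬ W.HasCM → W.analyticRank = 0 → Odd W.tamagawaProduct →
      ∀ (v : IsDedekindDomain.HeightOneSpectrum (NumberField.RingOfIntegers ℚ)), ((2 : ℕ) : NumberField.RingOfIntegers ℚ) ∉ v.asIdeal →
        ((W.conductorNorm ℤ : ℕ) : NumberField.RingOfIntegers ℚ) ∈ v.asIdeal → W.HasMultiplicativeReductionAt v → 0 < W.Δ →
      ∀ (K : Type) [Field K] [NumberField K], IsImaginaryQuadratic K → Odd (NumberField.discr K) → NumberField.discr K ≠ -3 →
        SatisfiesHeegnerHypothesis (W.conductorNorm ℤ) K → ¬ IsSquare ((NumberField.discr K : ℚ) * -|W.Δ|) →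
        ¬ IsSquare ((NumberField.discr K : ℚ) * (-(2 * |W.Δ|))) → (∀ n : ℕ, 0 < n → W.HasSurjectiveModNGaloisRep ((2 : ℤ) ^ n)) →
      ∀ (Dt : ModularParametrizationData W (W.conductorNorm ℤ)), Odd Dt.c →
      ∀ (β : ℤ) (ι : K →+* ℂ) (d₁ : KolyvaginHeegnerData Dt β ι 1), ¬ IsOfFinAddOrder d₁.derivedPoint → ∀ (M₀ : ℕ),
        (∃ Q : (W.baseChange (ringClassField K ι 1)).toAffine.Point, ((2 ^ M₀ : ℕ) : ℤ) • Q = d₁.derivedPoint) →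
        (¬ ∃ Q : (W.baseChange (ringClassField K ι 1)).toAffine.Point, ((2 ^ (M₀ + 1) : ℕ) : ℤ) • Q = d₁.derivedPoint) →
      ∀ (Wd : WeierstrassCurve ℚ) [Wd.IsElliptic] [Wd.IsGloballyMinimal],
        (∃ C : VariableChange ℚ, C • W.quadraticTwist (NumberField.discr K : ℚ) = Wd) → Wd.analyticRank = 1 →
        Nat.card (Wd.selmerGroup 2) = 2 → padicValNat 2 Wd.tamagawaProduct = 0 →
      ∀ (n : ℕ) (d : KolyvaginHeegnerData Dt β ι n), Squarefree n →
        (∀ ℓ ∈ n.primeFactors, Zhang2014.IsKolyvaginPrime (W.conductorNorm ℤ) W K 2 ℓ ∧ 2 ≤ Zhang2014.kolyvaginIndex W 2 ℓ ∧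
          ∃ (v : IsDedekindDomain.HeightOneSpectrum (NumberField.RingOfIntegers ℚ))
            (𝔓 : Ideal (Literature.NumberTheory.GaloisRepresentations.absIntegers (NumberField.RingOfIntegers ℚ) ℚ))
            (h : Field.absoluteGaloisGroup ℚ), ((ℓ : ℕ) : NumberField.RingOfIntegers ℚ) ∈ v.asIdeal ∧ 𝔓 ∈ v.primesAbove ∧
              IsArithFrobAt (NumberField.RingOfIntegers ℚ) h 𝔓 ∧ ∃ u : W.geomTorsion ((2 : ℕ) : ℤ), h • u ≠ u) →
        (¬ ∃ Q : (W.baseChange (ringClassField K ι n)).toAffine.Point, (2 : ℤ) • Q = d.derivedPoint) →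
        (BSDp W 2 ↔ BSDp Wd 2) := by
  intro W _ _ _ hcm hr0 hT v h2v hNv hmv hpos K _ _ hIQ hodd h3 hHe hsq1 hsq2 hρ Dt hc β ι d₁ hy M₀ hdiv hndiv Wd _ _ hWd hrd hSel hTam
    n d hn hKoly hPn
  have hw : W.rootNumber = 1 :=
    (Literature.Barriers.BirchSwinnertonDyer.even_analyticRank_iff_of_isNewformOf_conductorLevel Dt.isNewformOf).mp
      (by rw [hr0]; exact Even.zero)
  have hsha : Nat.card (AddCommGroup.primaryComponent (W.baseChange K).sha 2) = 2 ^ (2 * M₀) :=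
    hQ4T hQ2 W hcm hT v h2v hNv hmv hpos K hIQ hodd h3 hHe hsq1 hsq2 hρ Dt β ι d₁ hy M₀ hdiv hndiv hw Wd hWd hSel hTam n d hn hKoly hPn
  exact bsdp_iff_bsdp_twin_of_natCard_sha_eq_pow_of_facts hGZ hGZK hL hMi W hr0 (by simpa using hρ 1 one_pos) hT K hIQ hodd h3 hHe Dt hc
    β ι d₁ M₀ hdiv hndiv hsha Wd hWd hrd

end Summit.BirchSwinnertonDyer.BirchSwinnertonDyer.Theorems.GenusExact.TwinSwap.Ascent

end
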